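import Summits.CriticalPhenomena.SAWScalingLimit.Theorems.SAWRenewalTightnessRoomPassageDefs
import Summits.CriticalPhenomena.SAWScalingLimit.Theorems.SAWRenewalTightnessSubseqIdentificationPassageUI
import Summits.CriticalPhenomena.SAWScalingLimit.Theorems.SAWRenewalTightnessSubseqIdentificationRoomObsFunctional
import Summits.CriticalPhenomena.SAWScalingLimit.Theorems.SAWRenewalTightnessSubseqIdentificationRoomCylinderToMartingale
import Summits.CriticalPhenomena.SAWScalingLimit.Theorems.SAWRenewalTightnessSubseqIdentificationRoomEntropyCharacterisesSLECap
import Summits.CriticalPhenomena.SAWScalingLimit.Theorems.SubseqIdentification.Negative.ProbabilityRedundant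
import Summits.CriticalPhenomena.SAWScalingLimit.Theorems.SAWTotalPositivityTPToTraversalBoundChain
import Literature.Probability.RandomPlanarGeometry.SAWExplorationFiltration
import Literature.Probability.RandomPlanarGeometry.LoewnerHullReadout
import Literature.Probability.Process.DoobPassageData
import Literature.Probability.Process.FrozenCylinderExtension
import Literature.Probability.Process.NaturalFiltrationMartingale
import Literature.Probability.LatticeModels.KilledGreenMonotone
import HarnessLib

/-!
# `stub_roomPassageAssembly`: from the lattice room data to the capped room–entropy martingales

Stub `stub_roomPassageAssembly` of the registered skeleton (reshape r6b, time-capped passage) of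
the line `room-entropy-wright-fisher` for the crux `SubseqIdentification`
(stmt-CriticalPhenomena-0783, route `SAWRenewalTightness`, shared with `SAWParafermion` /
`SAWLeftRightFKG` / `SAWAsymptoticMorera`; vocabulary `Theorems/SAWRenewalTightnessRoomEntropyDefs`,
`Theorems/SAWRenewalTightnessRoomPassageDefs`): `SAWLatticeDrivers → LatticeRoomData →
RoomMartingaleLimitCap`. (H1) gives, for small meshes, continuous prefix-consistent drivers
`latticeDriver φ γ` of the pasts of every SAW (`DrivesPast`) with stem capacity `→ 0`, their
convergence in distribution to `drivingFunction φ` under describable subsequential limits, and the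
capacity facts in probability; (H2) gives uniform integrability of the terminal room deficit and
the approximation `|roomDoob - hullRoomObs(K_n, ξ_n, w)| ≤ ε` at all pasts of capacity
`≤ (Im w)²/16` off an event of probability `≤ ε`. Conclusion: the capped observables
`N^w_t = roomObsStopped W w ⌈(Im w)²/16⌉₊ (t ∧ (Im w)²/16)`, `W = drivingFunction φ`, are
martingales of the natural filtration of `W` under every describable probability subsequential
limit `μ`.

Proof. (1) `Process.martingale_natural_of_integral_cylinder` reduces to the cylinder identity
`E_μ[(N^w_t - N^w_s) ψ(W_S)] = 0` (`exists_filtration_martingale_roomObsCap_of_integral_cylinder`,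
capped twin of p100367). (2) `N^w` is frozen after `T_w = (Im w)²/16`, continuous and bounded, so
`s < t < T_w` suffices (`Process.integral_sub_mul_eq_zero_of_forall_lt_of_frozen`). (3) Then the
uniformly-integrable passage theorem `integral_cylinder_eq_zero_of_tendstoInDistribution_of_integrable`
(p101958) applies along the (shifted, `Negative.eventually_isProbabilityMeasure_law`) mesh
sequence with the drivers of (H1), the functional of `stub_roomObsFunctional` (p99035), and
per-scale data from `Process.exists_passageData_of_doob`, fed by: the exploration filtration and
Doob identity of the SAW (`SAW.exists_explorationFiltration`: `roomDoob = (π/2) E_δ[X_δ ∣ γ[0,n]]`),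
first passage indices of the capacity clock, `𝒢_σ`-measurability of `V_u`, `u ≤ s`
(prefix-consistency), `X_δ ≥ 0` (`SRW.killedGreen_fromRel_notMem_le`), UI of `X_δ` (H2), and,
off the capacity-overshoot event of (H1) and the approximation event of (H2), the identity
`N^w_u(V) = hullRoomObs(K_n, ξ_n, w)` at the capacity time `u = t_n ∈ [s, s + ρ]` of the first
passage (`roomObsStopped_capTime_eq_hullRoomObs`; the stem clause of (H1) covers index `0`).
No named fact; axioms `propext`, `Classical.choice`, `Quot.sound`.

References: Chelkak–Duminil-Copin–Hongler–Kemppainen–Smirnov, C. R. Math. 352 (2014), §3;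
Duminil-Copin–Smirnov, Clay Math. Proc. 15 (2012), Lemma 6.6, Prop. 6.7; Lawler–Schramm–Werner,
Proc. Sympos. Pure Math. 72 (2004), §3.4.
-/

noncomputable section

open MeasureTheory Filter Topology Set
open scoped NNReal ENNReal Classical BigOperators
open Literature.Probability.LatticeModels
open Literature.Probability.RandomPlanarGeometry
open UpperHalfPlane (upperHalfPlaneSet)
open scoped PathBorel

namespace Summit.CriticalPhenomena.SAWScalingLimit.Theorems.SubseqIdentification.RoomEntropy

/-! ## The capped observable at a capacity time of a driven past is the hull functional -/

/-- **`N^w` at the capacity time of a driven past** (`DrivesPast`, `Im w > 0`,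
`0 ≤ t_n ≤ (Im w)²/16`) is the hull functional `hullRoomObs K_n ξ_n w`: the cap is inactive, the
room stop has not occurred (`Loewner.le_sInf_roomLevel_of_sixteen_mul_le`), and `g_u, g_u', z_u`
are read off the hull (`Loewner.derivRatio_eq_of_hull_eq`, `Loewner.schrammObs_eq_of_hull_eq`). -/
theorem roomObsStopped_capTime_eq_hullRoomObs {D : DobrushinDomain}
    {φ : ConformalEquiv upperHalfPlaneSet D.carrier} {δ : ℝ} {a b : Site 2}
    {γ : SAW.DomainSAW D.carrier δ a b} {V : ℝ≥0 → ℝ} (hV : DrivesPast φ γ V) {w : ℂ}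
    (hw : 0 < w.im) {n : ℕ} (h0 : 0 ≤ LatticeSlit.capTime φ (prefixAt γ n))
    (hT : LatticeSlit.capTime φ (prefixAt γ n) ≤ w.im ^ 2 / 16) :
    roomObsStopped V w ⌈w.im ^ 2 / 16⌉₊
        (min (LatticeSlit.capTime φ (prefixAt γ n)).toNNReal (Real.toNNReal (w.im ^ 2 / 16))) =
      hullRoomObs (LatticeSlit.pastHull φ (prefixAt γ n))
        (LatticeSlit.drivingValue φ (prefixAt γ n)) w := by
  obtain ⟨hVc, hVn, -⟩ := hV
  obtain ⟨hval, hhull, hmap⟩ := hVn n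
  set u : ℝ≥0 := (LatticeSlit.capTime φ (prefixAt γ n)).toNNReal with hu
  have huc : (u : ℝ) = LatticeSlit.capTime φ (prefixAt γ n) := Real.coe_toNNReal _ h0
  have hw2 : 0 < w.im ^ 2 := by positivity
  have hu16 : 16 * (u : ℝ) ≤ w.im ^ 2 := by rw [huc]; linarith
  have hu4 : 4 * (u : ℝ) < w.im ^ 2 := by linarith [u.coe_nonneg]
  have hm : 1 ≤ ⌈w.im ^ 2 / 16⌉₊ := Nat.one_le_ceil_iff.2 (by positivity)
  have hum : (u : ℝ) ≤ (⌈w.im ^ 2 / 16⌉₊ : ℕ) + 1 := by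
    have := Nat.le_ceil (w.im ^ 2 / 16)
    rw [huc]
    linarith
  have hcap : min u (Real.toNNReal (w.im ^ 2 / 16)) = u :=
    min_eq_left (Real.toNNReal_le_toNNReal hT)
  have hstop := Loewner.le_sInf_roomLevel_of_sixteen_mul_le hVc hw hm hu16 hum
  rw [hcap]
  unfold roomObsStopped roomStop roomObs
  rw [min_eq_left hstop, Loewner.derivRatio_eq_of_hull_eq hVc hw hu4 hhull hmap,
    Loewner.schrammObs_eq_of_hull_eq hVc hw hu4 hhull hmap, hval]
  rfl

/-! ## From the capped cylinder identity to the martingales of the natural filtration -/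

/-- **Capped twin of `exists_filtration_martingale_roomObsStopped_of_integral_cylinder`**
(p100367): the cylinder identity of the CAPPED observables for all `w ∈ ℍ`, `s ≤ t`, `S_k ≤ s`,
continuous `|ψ| ≤ 1` makes every `N^w` a martingale of the natural filtration of
`W = drivingFunction φ` (`N^w_t` is `𝓕_{t ∧ T_w}`-measurable, `Loewner.adapted_roomObs_min_roomStop`;
bounded, `Loewner.abs_roomObs_min_roomStop_le`; `Process.martingale_natural_of_integral_cylinder`). -/
theorem exists_filtration_martingale_roomObsCap_of_integral_cylinder
    {D : DobrushinDomain} {φ : ConformalEquiv upperHalfPlaneSet D.carrier}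
    {μ : Measure (CurveClass ℂ)} (hφ : D.IsChordalUniformizing φ) [IsFiniteMeasure μ]
    (h : ∀ w : ℂ, 0 < w.im → ∀ (s t : ℝ≥0), s ≤ t → ∀ (n : ℕ) (S : Fin n → ℝ≥0),
      (∀ k, S k ≤ s) → ∀ ψ : (Fin n → ℝ) → ℝ, Continuous ψ → (∀ v, |ψ v| ≤ 1) →
        ∫ c, (roomObsStopped (drivingFunction φ c) w ⌈w.im ^ 2 / 16⌉₊
              (min t (Real.toNNReal (w.im ^ 2 / 16))) -
            roomObsStopped (drivingFunction φ c) w ⌈w.im ^ 2 / 16⌉₊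
              (min s (Real.toNNReal (w.im ^ 2 / 16)))) *
          ψ (fun k => drivingFunction φ c (S k)) ∂μ = 0) :
    ∃ 𝓕 : Filtration ℝ≥0 (inferInstance : MeasurableSpace (CurveClass ℂ)),
      Adapted 𝓕 (fun t c => drivingFunction φ c t) ∧
      ∀ w : ℂ, 0 < w.im →
        Martingale (fun t c => roomObsStopped (drivingFunction φ c) w ⌈w.im ^ 2 / 16⌉₊
          (min t (Real.toNNReal (w.im ^ 2 / 16)))) 𝓕 μ := by
  -- adapted from `exists_filtration_martingale_roomObsStopped_of_integral_cylinder` (p100367)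
  have hW : ∀ t : ℝ≥0, StronglyMeasurable fun c : CurveClass ℂ ↦ drivingFunction φ c t :=
    fun t ↦ stronglyMeasurable_drivingFunction_apply hφ t
  set 𝓕 : Filtration ℝ≥0 (inferInstance : MeasurableSpace (CurveClass ℂ)) :=
    Filtration.natural (fun (t : ℝ≥0) (c : CurveClass ℂ) ↦ drivingFunction φ c t) hW with h𝓕
  have hWad : Adapted 𝓕 fun (t : ℝ≥0) (c : CurveClass ℂ) ↦ drivingFunction φ c t :=
    (Filtration.stronglyAdapted_natural hW).adapted
  have hWc : ∀ c : CurveClass ℂ, Continuous (drivingFunction φ c) := fun c ↦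
    continuous_drivingFunction φ c
  refine ⟨𝓕, hWad, fun w hw ↦ ?_⟩
  have hXad0 : Adapted 𝓕 fun (t : ℝ≥0) (c : CurveClass ℂ) ↦
      roomObsStopped (drivingFunction φ c) w ⌈w.im ^ 2 / 16⌉₊ t :=
    Loewner.adapted_roomObs_min_roomStop (W := fun c : CurveClass ℂ ↦ drivingFunction φ c) 𝓕 hWc
      (fun s ↦ hWad s) hw _
  have hXad : Adapted 𝓕 fun (t : ℝ≥0) (c : CurveClass ℂ) ↦
      roomObsStopped (drivingFunction φ c) w ⌈w.im ^ 2 / 16⌉₊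
        (min t (Real.toNNReal (w.im ^ 2 / 16))) :=
    fun t ↦ (hXad0 (min t _)).mono (𝓕.mono (min_le_left t _)) le_rfl
  have hXsad := hXad.stronglyAdapted
  have hXint : ∀ t : ℝ≥0, Integrable (fun c : CurveClass ℂ ↦
      roomObsStopped (drivingFunction φ c) w ⌈w.im ^ 2 / 16⌉₊
        (min t (Real.toNNReal (w.im ^ 2 / 16)))) μ := by
    intro t
    refine Integrable.of_bound (hXsad.stronglyMeasurable (i := t)).aestronglyMeasurable
      (2 * Real.log ((⌈w.im ^ 2 / 16⌉₊ : ℝ) + 1) + 3 * Real.log 2) (ae_of_all _ fun c ↦ ?_)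
    rw [Real.norm_eq_abs]
    exact Loewner.abs_roomObs_min_roomStop_le (hWc c) hw _ _
  exact Literature.Probability.Process.martingale_natural_of_integral_cylinder hW hXsad hXint
    (h w hw)

/-! ## The assembly -/

/-- **`SAWLatticeDrivers → LatticeRoomData → RoomMartingaleLimitCap`** (registered stub
`stub_roomPassageAssembly` of the line `room-entropy-wright-fisher`, reshape r6b, crux
`SubseqIdentification`, stmt-CriticalPhenomena-0783): see the module docstring for the proof. -/
theorem stub_roomPassageAssembly :
    (∀ (D : DobrushinDomain) (a b : ℝ → Site 2) (φ : ConformalEquiv upperHalfPlaneSet D.carrier),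
      SAW.IsEndpointApprox D a b → D.IsChordalUniformizing φ →
      (∀ᶠ δ in 𝓝[>] (0 : ℝ), ∀ γ : SAW.DomainSAW D.carrier δ (a δ) (b δ),
        DrivesPast φ γ (latticeDriver φ γ)) ∧
      (∀ᶠ δ in 𝓝[>] (0 : ℝ), ∀ (γ γ' : SAW.DomainSAW D.carrier δ (a δ) (b δ)) (n : ℕ),
        (prefixAt γ n).support = (prefixAt γ' n).support →
        ∀ u : ℝ≥0, (u : ℝ) ≤ LatticeSlit.capTime φ (prefixAt γ n) →
          latticeDriver φ γ u = latticeDriver φ γ' u) ∧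
      (∀ ε : ℝ, 0 < ε → ∀ᶠ δ in 𝓝[>] (0 : ℝ), ∀ γ : SAW.DomainSAW D.carrier δ (a δ) (b δ),
        LatticeSlit.capTime φ (prefixAt γ 0) ≤ ε) ∧
      ∀ (μ : Measure (CurveClass ℂ)) (s : ℕ → ℝ) [IsProbabilityMeasure μ]
        [∀ n, IsProbabilityMeasure (SAW.law D.carrier (s n) (a (s n)) (b (s n)))],
        Tendsto s atTop (𝓝[>] (0 : ℝ)) →
        (∀ f : BoundedContinuousFunction (CurveClass ℂ) ℝ,
          Tendsto (fun n => ∫ γ, f γ.curve ∂(SAW.law D.carrier (s n) (a (s n)) (b (s n))))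
            atTop (𝓝 (∫ x, f x ∂μ))) →
        (∀ᵐ c ∂μ, IsLoewnerDescribable φ c ∧ c.source = D.pt 0) →
        TendstoInDistribution
            (fun n (γ : SAW.DomainSAW D.carrier (s n) (a (s n)) (b (s n))) =>
              (⟨latticeDriver φ γ, continuous_latticeDriver φ γ⟩ : C(ℝ≥0, ℝ)))
            atTop (fun c => (⟨drivingFunction φ c, continuous_drivingFunction φ c⟩ : C(ℝ≥0, ℝ)))
            (fun n => SAW.law D.carrier (s n) (a (s n)) (b (s n))) μ ∧
        ∀ T ε : ℝ, 0 < ε → ∀ᶠ n in atTop,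
          SAW.law D.carrier (s n) (a (s n)) (b (s n))
            {γ | LatticeSlit.capTime φ γ.walk ≤ T ∨
                  ∃ k : ℕ, LatticeSlit.capTime φ (prefixAt γ k) ≤ T ∧
                    ε < LatticeSlit.capTime φ (prefixAt γ (k + 1)) - LatticeSlit.capTime φ (prefixAt γ k)}
            ≤ ENNReal.ofReal ε) →
    (∀ (D : DobrushinDomain) (a b : ℝ → Site 2) (φ : ConformalEquiv upperHalfPlaneSet D.carrier),
      SAW.IsEndpointApprox D a b → D.IsChordalUniformizing φ →
      ∀ w : ℂ, 0 < w.im → ∀ (zδ : ℝ → Site 2),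
        Tendsto (fun δ => meshPoint δ (zδ δ)) (𝓝[>] (0 : ℝ)) (𝓝 (φ w)) →
      (∀ ε : ℝ, 0 < ε → ∃ R : ℝ, ∀ᶠ δ in 𝓝[>] (0 : ℝ),
        ∫ γ in {γ : SAW.DomainSAW D.carrier δ (a δ) (b δ) |
                  R < roomAt D.carrier δ ∅ (zδ δ) - roomAt D.carrier δ (verts γ.walk) (zδ δ)},
            (roomAt D.carrier δ ∅ (zδ δ) - roomAt D.carrier δ (verts γ.walk) (zδ δ))
          ∂(SAW.law D.carrier δ (a δ) (b δ)) ≤ ε) ∧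
      ∀ ε : ℝ, 0 < ε → ∀ᶠ δ in 𝓝[>] (0 : ℝ),
        SAW.law D.carrier δ (a δ) (b δ)
          {γ | ∃ n : ℕ, LatticeSlit.capTime φ (prefixAt γ n) ≤ w.im ^ 2 / 16 ∧
                ε < |roomDoob D δ (a δ) (b δ) (zδ δ) γ n -
                      hullRoomObs (LatticeSlit.pastHull φ (prefixAt γ n))
                        (LatticeSlit.drivingValue φ (prefixAt γ n)) w|}
          ≤ ENNReal.ofReal ε) →
    ∀ (D : DobrushinDomain) (a b : ℝ → Site 2)
      (φ : ConformalEquiv upperHalfPlaneSet D.carrier) (μ : Measure (CurveClass ℂ)),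
      SAW.IsEndpointApprox D a b → D.IsChordalUniformizing φ → IsProbabilityMeasure μ →
      IsSubseqLimitLaw (fun δ (γ : SAW.DomainSAW D.carrier δ (a δ) (b δ)) => γ.curve)
        (fun δ => SAW.law D.carrier δ (a δ) (b δ)) μ →
      (∀ᵐ c ∂μ, IsLoewnerDescribable φ c ∧ c.source = D.pt 0) →
      ∃ 𝓕 : Filtration ℝ≥0 (inferInstance : MeasurableSpace (CurveClass ℂ)),
        Adapted 𝓕 (fun t c => drivingFunction φ c t) ∧
        ∀ w : ℂ, 0 < w.im →
          Martingale (fun t c => roomObsStopped (drivingFunction φ c) w ⌈w.im ^ 2 / 16⌉₊ (min t (Real.toNNReal (w.im ^ 2 / 16)))) 𝓕 μ := by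
  intro H1 H2 D a b φ μ hab hφ hμ hsub hdesc
  haveI := hμ
  refine exists_filtration_martingale_roomObsCap_of_integral_cylinder hφ
    fun w hw s t hst n S hS ψ hψc hψ1 ↦ ?_
  /- the mesh sequence of the subsequential limit, shifted so that all laws are probability
  measures -/
  obtain ⟨s₀, hs₀, hlim₀⟩ := hsub
  obtain ⟨n₀, hn₀⟩ := eventually_atTop.1
    (hs₀.eventually (Negative.eventually_isProbabilityMeasure_law hab))
  obtain ⟨sq, hsq⟩ : ∃ sq : ℕ → ℝ, sq = fun k ↦ s₀ (k + n₀) := ⟨_, rfl⟩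
  have hsq0 : Tendsto sq atTop (𝓝[>] (0 : ℝ)) := by
    rw [hsq]; exact hs₀.comp (tendsto_add_atTop_nat n₀)
  haveI hP : ∀ k, IsProbabilityMeasure (SAW.law D.carrier (sq k) (a (sq k)) (b (sq k))) :=
    fun k ↦ by rw [hsq]; exact hn₀ _ (Nat.le_add_left _ _)
  have hlim : ∀ f : BoundedContinuousFunction (CurveClass ℂ) ℝ,
      Tendsto (fun k ↦ ∫ γ, f γ.curve ∂SAW.law D.carrier (sq k) (a (sq k)) (b (sq k))) atTop
        (𝓝 (∫ x, f x ∂μ)) := fun f ↦ by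
    rw [hsq]; exact (hlim₀ f).comp (tendsto_add_atTop_nat n₀)
  -- the inputs of (H1) and (H2)
  obtain ⟨hdrives, hconsist, hstem, H1c⟩ := H1 D a b φ hab hφ
  obtain ⟨hlaw, hcap⟩ := H1c μ sq hsq0 hlim hdesc
  obtain ⟨zδ, hzδ⟩ : ∃ zδ : ℝ → Site 2,
      Tendsto (fun δ ↦ meshPoint δ (zδ δ)) (𝓝[>] (0 : ℝ)) (𝓝 (φ w)) := by
    refine ⟨fun δ ↦ nearestSite δ (φ w), Metric.tendsto_nhds.2 fun ε hε ↦ ?_⟩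
    have e1 : ∀ᶠ δ in 𝓝[>] (0 : ℝ), δ < ε := mem_nhdsWithin_of_mem_nhds (Iio_mem_nhds hε)
    filter_upwards [e1, self_mem_nhdsWithin] with δ h1 hδ0
    exact (dist_meshPoint_nearestSite_le hδ0 _).trans_lt h1
  obtain ⟨hUI, happR⟩ := H2 D a b φ hab hφ w hw zδ hzδ
  -- the capped observable as a bounded, jointly continuous path functional
  have hTc : ((Real.toNNReal (w.im ^ 2 / 16) : ℝ≥0) : ℝ) = w.im ^ 2 / 16 :=
    Real.coe_toNNReal _ (by positivity)
  obtain ⟨hNc0, hNb0⟩ := stub_roomObsFunctional w hw ⌈w.im ^ 2 / 16⌉₊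
  have hrc : ∀ u : ℝ≥0, Continuous fun W : C(ℝ≥0, ℝ) ↦
      roomObsStopped W w ⌈w.im ^ 2 / 16⌉₊ (min u (Real.toNNReal (w.im ^ 2 / 16))) := fun u ↦ by
    have := hNc0.comp (Continuous.prodMk
      (continuous_const (y := min u (Real.toNNReal (w.im ^ 2 / 16)))) (continuous_id (X := C(ℝ≥0, ℝ))))
    exact this
  obtain ⟨N, hN⟩ : ∃ N : ℝ≥0 → C(ℝ≥0, ℝ) → ℂ, N = fun u (W : C(ℝ≥0, ℝ)) ↦
      ((roomObsStopped W w ⌈w.im ^ 2 / 16⌉₊ (min u (Real.toNNReal (w.im ^ 2 / 16))) : ℝ) : ℂ) :=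
    ⟨_, rfl⟩
  have hNc : Continuous (Function.uncurry N) := by
    have := Complex.continuous_ofReal.comp (hNc0.comp ((continuous_fst.min (continuous_const
      (y := Real.toNNReal (w.im ^ 2 / 16)))).prodMk continuous_snd))
    rw [hN]; exact this
  have hNC : ∀ u W, ‖N u W‖ ≤ 2 * Real.log ((⌈w.im ^ 2 / 16⌉₊ : ℝ) + 1) + 3 * Real.log 2 := by
    intro u W; rw [hN, Complex.norm_real, Real.norm_eq_abs]; exact hNb0 W W.continuous _
  /- the observable is frozen after the cap: it suffices to treat `s < t < T_w` -/
  refine Literature.Probability.Process.integral_sub_mul_eq_zero_of_forall_lt_of_frozen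
    (μ := μ) (T := Real.toNNReal (w.im ^ 2 / 16))
    (X := fun u c ↦ roomObsStopped (drivingFunction φ c) w ⌈w.im ^ 2 / 16⌉₊
      (min u (Real.toNNReal (w.im ^ 2 / 16))))
    (fun u hu c ↦ by simp only [min_eq_right hu, min_self])
    (fun c ↦ continuous_roomObsStopped_min (continuous_drivingFunction φ c) hw _ _)
    (fun u ↦ ((hrc u).measurable.comp_aemeasurable hlaw.aemeasurable_limit).aestronglyMeasurable)
    (fun u c ↦ hNb0 _ (continuous_drivingFunction φ c) _)
    ((hψc.measurable.comp (measurable_pi_lambda _ fun k ↦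
      (stronglyMeasurable_drivingFunction_apply hφ (S k)).measurable)).aestronglyMeasurable)
    (fun c ↦ hψ1 _) (fun t' hst' ht'T ↦ ?_) hst
  /- the case `s < t' < T_w`: passage along the mesh sequence; the terminal room deficits -/
  obtain ⟨X, hX⟩ : ∃ X : ∀ k, SAW.DomainSAW D.carrier (sq k) (a (sq k)) (b (sq k)) → ℝ,
      X = fun k γ ↦ roomAt D.carrier (sq k) ∅ (zδ (sq k)) -
        roomAt D.carrier (sq k) (verts γ.walk) (zδ (sq k)) := ⟨_, rfl⟩
  have hδpos : ∀ᶠ k in atTop, 0 < sq k := hsq0.eventually self_mem_nhdsWithin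
  have hXev : ∀ᶠ k in atTop, Measurable (X k) ∧ (∀ γ, 0 ≤ X k γ) ∧
      Integrable (X k) (SAW.law D.carrier (sq k) (a (sq k)) (b (sq k))) := by
    filter_upwards [hδpos] with k hδ
    haveI := TPToTraversalBound.Radial.finite_domainSAW D.isBounded hδ (a (sq k)) (b (sq k))
    refine ⟨SAW.DomainSAW.measurable_of_top _, fun γ ↦ ?_, Integrable.of_finite⟩
    rw [hX]; exact sub_nonneg.2 (SRW.killedGreen_fromRel_notMem_le
      (SRW.finite_support_discreteDomainGraph D.isBounded hδ) _ _ _)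
  have hUI' : ∀ ε : ℝ, 0 < ε → ∃ R : ℝ, ∀ᶠ k in atTop,
      ∫ γ in {γ | R < X k γ}, X k γ ∂SAW.law D.carrier (sq k) (a (sq k)) (b (sq k)) ≤ ε := by
    intro ε hε
    obtain ⟨R, hR⟩ := hUI ε hε
    exact ⟨R, by rw [hX]; exact hsq0.eventually hR⟩
  have main := fun hD ↦ Literature.Probability.Process.exists_passageData_of_doob
    (P := fun k ↦ SAW.law D.carrier (sq k) (a (sq k)) (b (sq k)))
    (V := fun k u γ ↦ latticeDriver φ γ u)
    (Φ := fun k u γ ↦ N u ⟨latticeDriver φ γ, continuous_latticeDriver φ γ⟩)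
    hXev hUI' (Real.pi / 2) s t' hS hψc.measurable hψ1 hD
  refine (main ?doob).elim fun ε hrest ↦ ?passage
  case passage =>
    obtain ⟨Δ, η, hε, hΔ, hη, happrox⟩ := hrest
    have key := integral_cylinder_eq_zero_of_tendstoInDistribution_of_integrable (μ := μ)
      (P := fun k ↦ SAW.law D.carrier (sq k) (a (sq k)) (b (sq k)))
      (W := fun u c ↦ drivingFunction φ c u) (fun c ↦ continuous_drivingFunction φ c)
      (V := fun k u γ ↦ latticeDriver φ γ u) (fun k γ ↦ continuous_latticeDriver φ γ)
      hlaw hNc hNC s t' S hψc hψ1 hε hΔ hη happrox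
    rw [hN] at key
    simp only [ContinuousMap.coe_mk, ← Complex.ofReal_sub, ← Complex.ofReal_mul,
      integral_complex_ofReal, Complex.ofReal_eq_zero] at key
    exact key
  /- the Doob data at every small tolerance `ρ` and every large scale `k` -/
  case doob =>
  have ht'r : (t' : ℝ) < w.im ^ 2 / 16 := by rw [← hTc]; exact_mod_cast ht'T
  filter_upwards [Ioo_mem_nhdsGT (sub_pos.2 ht'r)] with ρ ⟨hρ, hρT⟩
  have hρ2 : 0 < ρ / 2 := by positivity
  filter_upwards [hsq0.eventually hdrives, hsq0.eventually hconsist,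
    hsq0.eventually (hstem (ρ / 2) hρ2), hcap (w.im ^ 2 / 16) (ρ / 2) hρ2,
    hsq0.eventually (happR (ρ / 2) hρ2), hδpos] with k hdr hco hst0 hca hap hδ
  haveI := TPToTraversalBound.Radial.finite_domainSAW D.isBounded hδ (a (sq k)) (b (sq k))
  obtain ⟨𝒢, M, σ, τ, hσ, hτ, hστ, hτM, hMlen, h𝒢, hDoob, hσspec, hτspec, hσlt, -, hσmeas, hfull⟩ :=
    SAW.exists_explorationFiltration (fun (γ : SAW.DomainSAW D.carrier (sq k) (a (sq k)) (b (sq k)))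
      (n : ℕ) ↦ LatticeSlit.capTime φ (prefixAt γ n))
      (fun γ γ' n h ↦ SAW.apply_eq_of_support_eq
        (fun v (η : (discreteDomainGraph D.carrier (sq k)).Walk (a (sq k)) v) ↦
          LatticeSlit.capTime φ η) h)
      (show (s : ℝ) ≤ t' from NNReal.coe_le_coe.2 hst'.le)
  have hcapM : ∀ γ : SAW.DomainSAW D.carrier (sq k) (a (sq k)) (b (sq k)),
      LatticeSlit.capTime φ (prefixAt γ M) = LatticeSlit.capTime φ γ.walk := fun γ ↦
    SAW.apply_eq_of_support_eq
      (fun v (η : (discreteDomainGraph D.carrier (sq k)).Walk (a (sq k)) v) ↦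
        LatticeSlit.capTime φ η) (hfull γ M (hMlen γ))
  refine ⟨𝒢, fun n γ ↦ roomDoob D (sq k) (a (sq k)) (b (sq k)) (zδ (sq k)) γ n, σ, τ, hσ, M,
    {γ | LatticeSlit.capTime φ γ.walk ≤ w.im ^ 2 / 16 ∨
        ∃ j : ℕ, LatticeSlit.capTime φ (prefixAt γ j) ≤ w.im ^ 2 / 16 ∧
          ρ / 2 < LatticeSlit.capTime φ (prefixAt γ (j + 1)) - LatticeSlit.capTime φ (prefixAt γ j)} ∪
      {γ | ∃ n : ℕ, LatticeSlit.capTime φ (prefixAt γ n) ≤ w.im ^ 2 / 16 ∧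
        ρ / 2 < |roomDoob D (sq k) (a (sq k)) (b (sq k)) (zδ (sq k)) γ n -
          hullRoomObs (LatticeSlit.pastHull φ (prefixAt γ n))
            (LatticeSlit.drivingValue φ (prefixAt γ n)) w|},
    hτ, ?_, ?_, hστ, hτM, ?_, MeasurableSpace.measurableSet_top, ?_, ?_⟩
  · -- `roomDoob` is adapted to the exploration
    refine fun n ↦ (h𝒢 n _ fun γ γ' h ↦ ?_).stronglyMeasurable
    exact congrArg (fun r : ℝ ↦ Real.pi / 2 * (roomAt D.carrier (sq k) ∅ (zδ (sq k)) - r))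
      (SAW.apply_eq_of_support_eq
        (fun v (η : (discreteDomainGraph D.carrier (sq k)).Walk (a (sq k)) v) ↦
          condRoom D.carrier (sq k) (a (sq k)) (b (sq k)) (zδ (sq k)) η) h)
  · -- `roomDoob` IS `(π/2) E_δ[X ∣ γ[0,n]]`
    intro n
    have hsub : X k = (fun _ ↦ roomAt D.carrier (sq k) ∅ (zδ (sq k))) -
        fun γ ↦ roomAt D.carrier (sq k) (verts γ.walk) (zδ (sq k)) := by rw [hX]; rfl
    filter_upwards [condExp_sub (μ := SAW.law D.carrier (sq k) (a (sq k)) (b (sq k)))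
      (integrable_const (roomAt D.carrier (sq k) ∅ (zδ (sq k))))
      (Integrable.of_finite (f := fun γ ↦ roomAt D.carrier (sq k) (verts γ.walk) (zδ (sq k))))
      (𝒢 n), hDoob (SAW.law D.carrier (sq k) (a (sq k)) (b (sq k)))
      (fun γ ↦ roomAt D.carrier (sq k) (verts γ.walk) (zδ (sq k))) n] with γ h1 h2
    rw [hsub, h1, Pi.sub_apply, condExp_const (𝒢.le n), h2]; rfl
  · -- the driver values at times `≤ s` are `𝒢_σ`-measurable (prefix-consistency)
    intro u hu
    refine hσmeas _ fun j γ γ' hj hjM h ↦ hco γ γ' j h u ?_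
    exact (NNReal.coe_le_coe.2 hu).trans (hσlt γ j hj hjM)
  · -- the exceptional event is small
    refine (measure_union_le _ _).trans ((add_le_add hca hap).trans ?_)
    rw [← ENNReal.ofReal_add hρ2.le hρ2.le, add_halves]
  · -- off the exceptional event: the approximations at the first passages past `s`, `t'`
    intro γ hγ
    simp only [mem_union, mem_setOf_eq, not_or, not_exists, not_and, not_lt] at hγ
    obtain ⟨⟨hwalk, hincr⟩, happx⟩ := hγ
    rw [not_le] at hwalk
    have key : ∀ (lv : ℝ≥0) (θ : SAW.DomainSAW D.carrier (sq k) (a (sq k)) (b (sq k)) → WithTop ℕ),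
        (lv : ℝ) + ρ ≤ w.im ^ 2 / 16 →
        (∃ j : ℕ, θ γ = j ∧ j ≤ M ∧ ((lv : ℝ) ≤ LatticeSlit.capTime φ (prefixAt γ M) →
          (lv : ℝ) ≤ LatticeSlit.capTime φ (prefixAt γ j) ∧
            ∀ i < j, LatticeSlit.capTime φ (prefixAt γ i) < lv)) →
        ∃ u : ℝ≥0, lv ≤ u ∧ (u : ℝ) ≤ lv + ρ ∧
          ‖((stoppedValue (fun n γ ↦ roomDoob D (sq k) (a (sq k)) (b (sq k)) (zδ (sq k)) γ n)
              θ γ : ℝ) : ℂ) -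
            N u ⟨latticeDriver φ γ, continuous_latticeDriver φ γ⟩‖ ≤ ρ := by
      intro lv θ hlv ⟨j, hθj, hjM, hspec⟩
      obtain ⟨hhit, hbefore⟩ := hspec (by rw [hcapM]; linarith)
      have hup : LatticeSlit.capTime φ (prefixAt γ j) ≤ lv + ρ / 2 := by
        rcases j with _ | i
        · exact (hst0 γ).trans (by linarith [lv.coe_nonneg])
        · have hi : LatticeSlit.capTime φ (prefixAt γ i) < lv := hbefore i (Nat.lt_succ_self i)
          have := hincr i (by linarith)
          linarith
      have h0 : 0 ≤ LatticeSlit.capTime φ (prefixAt γ j) := lv.coe_nonneg.trans hhit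
      have hT : LatticeSlit.capTime φ (prefixAt γ j) ≤ w.im ^ 2 / 16 := by linarith
      refine ⟨(LatticeSlit.capTime φ (prefixAt γ j)).toNNReal, ?_, ?_, ?_⟩
      · rw [← NNReal.coe_le_coe, Real.coe_toNNReal _ h0]; exact hhit
      · rw [Real.coe_toNNReal _ h0]; linarith
      have hsv : stoppedValue (fun n γ ↦ roomDoob D (sq k) (a (sq k)) (b (sq k)) (zδ (sq k)) γ n)
          θ γ = roomDoob D (sq k) (a (sq k)) (b (sq k)) (zδ (sq k)) γ j := by
        simp only [stoppedValue, hθj]; rfl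
      rw [hsv, hN]
      simp only [ContinuousMap.coe_mk]
      rw [roomObsStopped_capTime_eq_hullRoomObs (hdr γ) hw h0 hT, ← Complex.ofReal_sub,
        Complex.norm_real, Real.norm_eq_abs]
      exact (happx j hT).trans (by linarith)
    exact ⟨key s σ (by linarith [NNReal.coe_lt_coe.2 hst']) (hσspec γ),
      key t' τ (by linarith) (hτspec γ)⟩

end Summit.CriticalPhenomena.SAWScalingLimit.Theorems.SubseqIdentification.RoomEntropy

end
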